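import Literature.Computability.Cryptography.RegevSamplerGeometry
import HarnessLib

/-!
# Regev 2009, Lemma 3.14 in machine form: the width parameter of a stage

Topic `Literature/Computability/Cryptography`, grouping namespace `Regev2009.SamplerRegs`; glue between the
machine bound `tvDist_machineCirc_le` (stated for a width `t`, with the promise `√n/t ≤ λ₁(L*)/2`, the target
`D_{L, t/√2}` and the grid scale `D_t = R|det B|/t`) and the named fact
`regev2009_lemma_3_14_stepFamily` (A_q14), whose stage `k` has radius `ρ_k = levelRadius θ (3n) r k`,
promise `αq/(√2 ρ_k) < λ₁(L*)/2` and target `D_{L, ρ_k √n/(αq)}` [Regev2009, Lemma 3.14 with Lemma 3.3]: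

* `tW aq d n = √2·d·√n/aq` — the width of the stage with radius `d = ρ_k` and `aq = α(n)·q(n)`; then
  `√n / tW = aq/(√2 d)` (`sqrt_div_tW`) and `tW/√2 = d√n/aq` (`tW_div_sqrt_two`);
* `Spar R D aq d n = (R·D·aq)²/(4 d² n) ∈ ℚ` — the RATIONAL Gaussian parameter of the cosine machine:
  `(Spar R |det B| aq d n : ℝ) = D_t²/2` for `t = tW aq d n` (`cast_Spar`), so that the block's parameter
  `c = 2π/D_t²` is `π/Spar` (`two_pi_div_sq_eq`) as `GRMassTable.accurate_tableT(c)` wants, and `1 ≤ Spar`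
  from `2 ≤ D_t²` (`one_le_Spar`).

Everything here is proved (elementary algebra); no named fact is introduced.

## References

* O. Regev, *On lattices, learning with errors, random linear codes, and cryptography*, J. ACM 56 (2009),
  art. 34, Lemma 3.14 (proof), Lemma 3.3 (proof), §2 p. 11 [Regev2009].
-/

noncomputable section

namespace Literature.Computability.Cryptography

namespace Regev2009

namespace SamplerRegs

open Literature.Algebra.EuclideanLattices Literature.Algebra.EuclideanLattices.Regev2009 SamplerArith SamplerGeom
open scoped Real

/-! ### The width of a stage -/

/-- **The width of the stage** with radius `d` and `aq = α q`: `t = √2·d·√n / (αq)`.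
[cite: Regev2009, Lemma 3.14 (proof) with Lemma 3.3] -/
def tW (aq d : ℝ) (n : ℕ) : ℝ := Real.sqrt 2 * d * Real.sqrt n / aq

/-- `0 < t`. [folklore] -/
theorem tW_pos {aq d : ℝ} {n : ℕ} (haq : 0 < aq) (hd : 0 < d) (hn : 0 < n) : 0 < tW aq d n := by
  unfold tW
  have : 0 < Real.sqrt n := Real.sqrt_pos.2 (by exact_mod_cast hn)
  positivity

/-- **The promise parameter**: `√n / t = αq / (√2 d)`. [cite: Regev2009, Lemma 3.14 (proof)] -/
theorem sqrt_div_tW {aq d : ℝ} {n : ℕ} (haq : 0 < aq) (hd : 0 < d) (hn : 0 < n) :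
    Real.sqrt n / tW aq d n = aq / (Real.sqrt 2 * d) := by
  unfold tW
  have hn' : 0 < Real.sqrt n := Real.sqrt_pos.2 (by exact_mod_cast hn)
  have h2 : 0 < Real.sqrt 2 := Real.sqrt_pos.2 (by norm_num)
  field_simp

/-- **The target width**: `t / √2 = d √n / (αq)`. [cite: Regev2009, Lemma 3.14 (proof)] -/
theorem tW_div_sqrt_two (aq d : ℝ) (n : ℕ) : tW aq d n / Real.sqrt 2 = d * Real.sqrt n / aq := by
  unfold tW
  have h2 : 0 < Real.sqrt 2 := Real.sqrt_pos.2 (by norm_num)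
  field_simp

/-! ### The rational Gaussian parameter -/

/-- **The rational Gaussian parameter of the cosine machine**: `S = (R·D·aq)² / (4 d² n)`.
[cite: Regev2009, Lemma 3.12 (proof) with §2 p. 11] -/
def Spar (R D : ℕ) (aq d : ℚ) (n : ℕ) : ℚ := ((R : ℚ) * D * aq) ^ 2 / (4 * d ^ 2 * n)

variable (I : LatticeInstance) (R : ℕ)

/-- **The grid scale at the stage width**: `D_t = R|det B|·aq / (√2 d √n)`. [cite: Regev2009, Lemma 3.14 (proof)] -/
theorem DT_tW {aq d : ℝ} {n : ℕ} (haq : 0 < aq) (hd : 0 < d) (hn : 0 < n) :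
    DT I R (tW aq d n) = (R : ℝ) * (detA I : ℝ) * aq / (Real.sqrt 2 * d * Real.sqrt n) := by
  unfold DT tW Dg
  have hn' : 0 < Real.sqrt n := Real.sqrt_pos.2 (by exact_mod_cast hn)
  have h2 : 0 < Real.sqrt 2 := Real.sqrt_pos.2 (by norm_num)
  push_cast
  field_simp

/-- **`S = D_t²/2`** at the stage width, `n = I.n`-free form: for `t = tW aq d n`,
`(Spar R |det B| aq d n : ℝ) = D_t² / 2`. [cite: Regev2009, Lemma 3.12 (proof) with §2 p. 11] -/
theorem cast_Spar {aq d : ℚ} {n : ℕ} (haq : 0 < aq) (hd : 0 < d) (hn : 0 < n) :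
    ((Spar R (detA I) aq d n : ℚ) : ℝ) = DT I R (tW (aq : ℝ) (d : ℝ) n) ^ 2 / 2 := by
  rw [DT_tW I R (by exact_mod_cast haq) (by exact_mod_cast hd) hn, Spar]
  have hn' : 0 < Real.sqrt n := Real.sqrt_pos.2 (by exact_mod_cast hn)
  have h2 : Real.sqrt 2 ^ 2 = 2 := Real.sq_sqrt (by norm_num)
  have hnn : Real.sqrt n ^ 2 = n := Real.sq_sqrt (Nat.cast_nonneg n)
  have hd' : (0 : ℝ) < d := by exact_mod_cast hd
  have hn0 : (0 : ℝ) < n := by exact_mod_cast hn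
  push_cast
  rw [div_pow, show (Real.sqrt 2 * (d : ℝ) * Real.sqrt n) ^ 2 = 2 * (d : ℝ) ^ 2 * n by rw [mul_pow, mul_pow, h2, hnn]]
  field_simp
  ring

/-- **The block's Gaussian parameter is `π/S`**: `2π/D_t² = π / Spar`. [cite: Regev2009, Lemma 3.12 (proof) with §2 p. 11] -/
theorem two_pi_div_sq_eq {aq d : ℚ} {n : ℕ} (haq : 0 < aq) (hd : 0 < d) (hn : 0 < n) :
    2 * π / DT I R (tW (aq : ℝ) (d : ℝ) n) ^ 2 = π / ((Spar R (detA I) aq d n : ℚ) : ℝ) := by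
  rw [cast_Spar I R haq hd hn]
  field_simp

/-- **`1 ≤ S`** from `2 ≤ D_t²`. [folklore] -/
theorem one_le_Spar {aq d : ℚ} {n : ℕ} (haq : 0 < aq) (hd : 0 < d) (hn : 0 < n)
    (h : 2 ≤ DT I R (tW (aq : ℝ) (d : ℝ) n) ^ 2) : 1 ≤ Spar R (detA I) aq d n := by
  have h' : (1 : ℝ) ≤ ((Spar R (detA I) aq d n : ℚ) : ℝ) := by rw [cast_Spar I R haq hd hn]; linarith
  exact_mod_cast h'

end SamplerRegs

end Regev2009

end Literature.Computability.Cryptography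

end
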